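import Summits.ResolutionOfSingularities.ResolutionOfSingularities.Theorems.FrobeniusLadderFInjectiveMacaulayficationCIChartPresentationLocal
import Summits.ResolutionOfSingularities.ResolutionOfSingularities.Theorems.FrobeniusLadderFInjectiveMacaulayficationCIFedderAtMaximalIdeal
import HarnessLib

/-!
# CI chart presentation (C1ᶜⁱ), part 5: the bridge to the chart-quotient local rings `(k[Y]⧸(g))_{Q'}`
# (crux `FInjectiveMacaulayfication`, CI-CN engine kernel, CRUX-PLAN w45a v9 piece C1ᶜⁱ; seat res-L1-w45a-stub-1)

[OURS · L1 W4.5a] Support file for crux stmt-ResolutionOfSingularities-15315. AI-written, weaker than expert review; no statement of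
[claim: Hironaka2017] is used. `CIChartPresentationLocal.nonempty_localization_ringEquiv` presents the local ring `B_𝔔` of the strict-transform
chart `B = R[I_A R/x̄^m]` (`R = k[X]/(F₁, …, F_c)`) as `k[Y]_Q̃ ⧸ (g₁, …, g_c)` (`Q̃ = φ⁻¹𝔔`); res-L1-w45a-stub-6's chart clause
`CIChartClause.ciChartClause` / `CIFedderAtMaximalIdeal.ci_fedderAtMaximalIdeal` is stated for `Localization.AtPrime Q'` with `Q'` a maximal
ideal of `k[Y] ⧸ (g₁, …, g_c)`. This file is the plumbing between the two shapes:
* `exists_isMaximal_comap_eq` — for a surjection `φ : k[Y] ↠ B'` with `G ⊆ ker φ` and a maximal `𝔔 ⊆ B'`, the ideal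
  `Q' = (φ⁻¹𝔔)/G` of `k[Y] ⧸ G` is maximal with contraction `φ⁻¹𝔔`;
* `nonempty_localization_ringEquiv_quotientChart` — `B_𝔔 ≃+* (k[Y]⧸(g))_{Q'}` whenever `Q'` contracts to `φ⁻¹𝔔` and the variables in
  `φ⁻¹𝔔` are non-zero-divisors on `k[Y]_{φ⁻¹𝔔} ⧸ (g)` (the binder of part 3, discharged from the orbit expected dimension by
  `CIChartPresentationLocal.isSMulRegular_algebraMap_X_of_expectedDim`; by `CIExpectedDim` the same hypothesis yields `ciChartClause`'s
  `dim + r = n`). Composition of part 3 with stub-6's `CIFedderAtMaximalIdeal.nonempty_quotLocalizationEquiv` through a `subst` on the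
  contracted prime. So the G5ᶜⁱ glue transports the clause `(k[Y]⧸(g))_{Q'} ↦ B_𝔔` by `GradedChartClauseAssembly.clause_atPrime_of_ringEquiv`.
No definition is declared. [folklore]
-/

set_option linter.dupNamespace false

noncomputable section

open MvPolynomial Literature.AlgebraicGeometry.Resolution

namespace Summit.ResolutionOfSingularities.ResolutionOfSingularities.Theorems.FInjectiveMacaulayfication.CIChartPresentationBridge

open Summit.ResolutionOfSingularities.ResolutionOfSingularities.Theorems.FInjectiveMacaulayfication

variable {n : ℕ} {k : Type} [Field k]

/-- **The maximal ideal of `k[Y] ⧸ G` under a point of `B'`.** For a surjection `φ : k[Y] ↠ B'` with `G ⊆ ker φ` and a maximal ideal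
`𝔔` of `B'`, `Q' = (φ⁻¹𝔔)·(k[Y] ⧸ G)` is a maximal ideal of `k[Y] ⧸ G` contracting to `φ⁻¹𝔔`. [folklore] -/
theorem exists_isMaximal_comap_eq {B' : Type} [CommRing B'] (φ : MvPolynomial (Fin n) k →+* B')
    (hsurj : Function.Surjective φ) (G : Ideal (MvPolynomial (Fin n) k)) (hG : G ≤ RingHom.ker φ)
    (𝔔 : Ideal B') [𝔔.IsMaximal] :
    ∃ Q' : Ideal (MvPolynomial (Fin n) k ⧸ G), Q'.IsMaximal ∧ Q'.comap (Ideal.Quotient.mk G) = 𝔔.comap φ := by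
  haveI hmax : (𝔔.comap φ).IsMaximal := Ideal.comap_isMaximal_of_surjective φ hsurj
  have hcomap : ((𝔔.comap φ).map (Ideal.Quotient.mk G)).comap (Ideal.Quotient.mk G) = 𝔔.comap φ := by
    rw [Ideal.comap_map_of_surjective _ Ideal.Quotient.mk_surjective, ← RingHom.ker_eq_comap_bot, Ideal.mk_ker,
      sup_eq_left]
    exact hG.trans (fun x hx => by
      rw [Ideal.mem_comap]
      rw [RingHom.mem_ker] at hx
      rw [hx]
      exact 𝔔.zero_mem)
  refine ⟨(𝔔.comap φ).map (Ideal.Quotient.mk G), ?_, hcomap⟩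
  rcases Ideal.map_eq_top_or_isMaximal_of_surjective (Ideal.Quotient.mk G) Ideal.Quotient.mk_surjective hmax with htop | hm
  · exfalso
    apply hmax.ne_top
    rw [← hcomap, htop, Ideal.comap_top]
  · exact hm

section Chart

variable (V : Matrix (Fin n) (Fin n) ℕ)
  (hV : IsUnit (V.map (Nat.cast : ℕ → ℤ)).det) (m : Fin n →₀ ℕ) (a : Fin n → (Fin n →₀ ℕ))
  (hgen : ∀ i : Fin n, (Finsupp.equivFunOnFinite.symm (V.mulVec ⇑(a i)) : Fin n →₀ ℕ) =
    Finsupp.equivFunOnFinite.symm (V.mulVec ⇑m) + Finsupp.single i 1)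
  (A : Finset (Fin n →₀ ℕ))
  {c : ℕ} (Fs gs : Fin c → MvPolynomial (Fin n) k) (d : Fin c → (Fin n →₀ ℕ))
  (hθF : ∀ i : Fin c, aeval (fun j : Fin n => ∏ l : Fin n, (X l : MvPolynomial (Fin n) k) ^ V l j) (Fs i) =
    monomial (d i) (1 : k) * gs i)
  (hunit : ∀ i : Fin c, ∃ (N : ℕ) (r : Fin n →₀ ℕ), N • m = ∑ j : Fin n, d i j • a j + r)

include hV hgen hθF hunit in
/-- **`B_𝔔 ≃+* (k[Y]⧸(g₁, …, g_c))_{Q'}`** — the local ring of the strict-transform chart at a prime `𝔔` IS the local ring of the naive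
chart quotient `k[Y]⧸(g)` at the corresponding prime `Q'` (`Q'` contracting to `φ⁻¹𝔔`), as soon as the variables in `φ⁻¹𝔔` are
non-zero-divisors on `k[Y]_{φ⁻¹𝔔} ⧸ (g)` (orbit expected dimension, part 3). [folklore] -/
theorem nonempty_localization_ringEquiv_quotientChart (φ : MvPolynomial (Fin n) k →+* ↥(blowupAlgebra
          (Ideal.span ((fun e : Fin n →₀ ℕ => Ideal.Quotient.mk (Ideal.span (Set.range Fs)) (monomial e (1 : k))) '' (A : Set _)))
          (Ideal.Quotient.mk (Ideal.span (Set.range Fs)) (monomial m (1 : k)))))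
    (hsurj : Function.Surjective φ) (hφ : ∀ q : MvPolynomial (Fin n) k, (φ q).val = aeval (fun i : Fin n => algebraMap (MvPolynomial (Fin n) k ⧸ Ideal.span (Set.range Fs))
          (Localization.Away (Ideal.Quotient.mk (Ideal.span (Set.range Fs)) (monomial m (1 : k))))
          (Ideal.Quotient.mk (Ideal.span (Set.range Fs)) (monomial (a i) (1 : k))) *
          IsLocalization.Away.invSelf (Ideal.Quotient.mk (Ideal.span (Set.range Fs)) (monomial m (1 : k)))) q)
    (𝔔 : Ideal ↥(blowupAlgebra
          (Ideal.span ((fun e : Fin n →₀ ℕ => Ideal.Quotient.mk (Ideal.span (Set.range Fs)) (monomial e (1 : k))) '' (A : Set _)))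
          (Ideal.Quotient.mk (Ideal.span (Set.range Fs)) (monomial m (1 : k))))) [𝔔.IsPrime]
    (Q' : Ideal (MvPolynomial (Fin n) k ⧸ Ideal.span (Set.range gs))) [Q'.IsPrime]
    (hQ' : Q'.comap (Ideal.Quotient.mk (Ideal.span (Set.range gs))) = 𝔔.comap φ)
    (hX : ∀ i : Fin n, (X i : MvPolynomial (Fin n) k) ∈ Q'.comap (Ideal.Quotient.mk (Ideal.span (Set.range gs))) →
      IsSMulRegular (Localization.AtPrime (Q'.comap (Ideal.Quotient.mk (Ideal.span (Set.range gs)))) ⧸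
          (Ideal.span (Set.range gs)).map (algebraMap (MvPolynomial (Fin n) k)
            (Localization.AtPrime (Q'.comap (Ideal.Quotient.mk (Ideal.span (Set.range gs)))))))
        (algebraMap (MvPolynomial (Fin n) k)
          (Localization.AtPrime (Q'.comap (Ideal.Quotient.mk (Ideal.span (Set.range gs))))) (X i))) :
    Nonempty (Localization.AtPrime 𝔔 ≃+* Localization.AtPrime Q') := by
  -- part 3 at a prime `P` EQUAL to `φ⁻¹𝔔` (subst), applied to `P := Q' ∩ k[Y]`
  have key : ∀ (P : Ideal (MvPolynomial (Fin n) k)) [P.IsPrime], P = 𝔔.comap φ →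
      (∀ i : Fin n, (X i : MvPolynomial (Fin n) k) ∈ P →
        IsSMulRegular (Localization.AtPrime P ⧸ (Ideal.span (Set.range gs)).map
            (algebraMap (MvPolynomial (Fin n) k) (Localization.AtPrime P)))
          (algebraMap (MvPolynomial (Fin n) k) (Localization.AtPrime P) (X i))) →
      Nonempty (Localization.AtPrime 𝔔 ≃+* Localization.AtPrime P ⧸ (Ideal.span (Set.range gs)).map
        (algebraMap (MvPolynomial (Fin n) k) (Localization.AtPrime P))) := by
    intro P _ hP hXP
    subst hP
    exact CIChartPresentationLocal.nonempty_localization_ringEquiv V hV m a hgen A Fs gs d hθF hunit φ hsurj hφ 𝔔 hXP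
  obtain ⟨ε₁⟩ := key _ hQ' hX
  obtain ⟨ε₂⟩ := CIFedderAtMaximalIdeal.nonempty_quotLocalizationEquiv (MvPolynomial (Fin n) k) (Ideal.span (Set.range gs)) Q'
  exact ⟨ε₁.trans ε₂⟩

end Chart

end Summit.ResolutionOfSingularities.ResolutionOfSingularities.Theorems.FInjectiveMacaulayfication.CIChartPresentationBridge

end
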